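import Literature.AnabelianGeometry.SemiGraphs.Coverticial
import Literature.AnabelianGeometry.AbsoluteAnabelian.AbsTopISemiAbsolute
import Mathlib.GroupTheory.Finiteness
import HarnessLib

/-!
# [AbsTopI] Prop 2.2 at the model: pro-`Σ` completions of finitely generated groups — in particular
# pro-`Σ` surface groups — are topologically finitely generated

Topic `AnabelianGeometry/SemiGraphs`, namespace
`Literature.AnabelianGeometry.SemiGraphs.SemiGraphOfAnabelioids.IsProSigmaCompletion`.
THEOREMS ONLY (no definition, no named fact).

S. Mochizuki, *Topics in Absolute Anabelian Geometry I* (2012) [AbsTopI], Prop 2.2 p. 18 ("Any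
profinite group `Δ` of GFG-type is topologically finitely generated"); typed in the abc-iut cell as the
predicate `FundamentalExtension.GeomTFG` (FACT-LIST row F-0240), the hypothesis `hΔ : E.GeomTFG` of the
discharges of [AbsTopI] Thm 2.6 (i), (ii), (iv), (v), (vi) and Prop 2.3 (ii).  AT THE MODEL —
`Δ` a pro-`Σ` completion (abc-iut-L3-t1's `IsProSigmaCompletion Sigma ι`, [SemiAnbd] Ex. 2.10) of a
finitely generated group `Γ`, e.g. of a (punctured) surface group `Γ_{g,r}` — the statement is immediate:
the images under `ι` of finitely many generators of `Γ` generate a dense subgroup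
(`isTopologicallyFinitelyGenerated_of_isProSigmaCompletion`), whence
`FundamentalExtension.geomTFG_of_isProSigmaCompletion` for every extension `1 → Δ → Π → G → 1` whose `Δ`
is so presented.  HONEST SCOPE: MODEL-level; the abstract `GeomTFG` of an arbitrary typed extension
stays a hypothesis elsewhere; nothing here bears on [IUTchIII] Cor. 3.12; typed ≠ proved elsewhere.

## References

* S. Mochizuki, *Topics in Absolute Anabelian Geometry I: Generalities*, J. Math. Sci. Univ. Tokyo 19
  (2012), Prop 2.2 p. 18. [MochizukiAbsTopI2012]
* S. Mochizuki, *Semi-graphs of Anabelioids*, Publ. RIMS 42 (2006), Example 2.10 p. 31.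
  [MochizukiSemiAnbd2006]
-/

noncomputable section

universe u

namespace Literature.AnabelianGeometry.SemiGraphs.SemiGraphOfAnabelioids.IsProSigmaCompletion

open Literature.AnabelianGeometry.AbsoluteAnabelian Topology
open Literature.GroupTheory.CombinatorialGroupTheory

variable {Sigma : Set ℕ} {Γ : Type*} [Group Γ] {P : Type*} [Group P] [TopologicalSpace P]
  [IsTopologicalGroup P] {ι : Γ →* P}

/-- **A pro-`Σ` completion of a finitely generated group is topologically finitely generated**: if
`Γ = ⟨s⟩` for a finite `s`, the images `ι(s)` generate the dense subgroup `ι(Γ)` of `P`.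
[cite: MochizukiAbsTopI2012, Prop 2.2 p.18] [cite: MochizukiSemiAnbd2006, Ex. 2.10 p.31] -/
theorem isTopologicallyFinitelyGenerated_of_closure_eq_top (hι : IsProSigmaCompletion Sigma ι)
    (s : Finset Γ) (hs : Subgroup.closure (s : Set Γ) = ⊤) : IsTopologicallyFinitelyGenerated P := by
  classical
  refine ⟨⟨s.image ι, ?_⟩⟩
  have hcl : Subgroup.closure ((s.image ι : Finset P) : Set P) = ι.range := by
    rw [Finset.coe_image, ← MonoidHom.map_closure, hs, ← MonoidHom.range_eq_map]
  rw [hcl, ← SetLike.coe_set_eq, Subgroup.topologicalClosure_coe, Subgroup.coe_top,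
    MonoidHom.coe_range]
  exact hι.dense.closure_eq

/-- **A pro-`Σ` completion of a finitely generated group is topologically finitely generated**
(`Group.FG` form). [cite: MochizukiAbsTopI2012, Prop 2.2 p.18] -/
theorem isTopologicallyFinitelyGenerated_of_fg [hΓ : Group.FG Γ] (hι : IsProSigmaCompletion Sigma ι) :
    IsTopologicallyFinitelyGenerated P := by
  obtain ⟨s, hs⟩ := hΓ.out
  exact isTopologicallyFinitelyGenerated_of_closure_eq_top hι s hs

/-- A finitely presented group on a finite type of generators is finitely generated (the images of the
generators generate). [folklore] -/
private theorem fg_presentedGroup {α : Type*} [Finite α] (rels : Set (FreeGroup α)) :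
    Group.FG (PresentedGroup rels) := by
  classical
  haveI := Fintype.ofFinite α
  refine ⟨⟨Finset.univ.image (PresentedGroup.of : α → PresentedGroup rels), ?_⟩⟩
  rw [Finset.coe_image, Finset.coe_univ, Set.image_univ]
  exact PresentedGroup.closure_range_of rels

/-- **Pro-`Σ` completions of the punctured surface groups `Γ_{g,r}` are topologically finitely
generated** — [AbsTopI] Prop 2.2 at the model of the geometric fundamental group of a hyperbolic curve
of type `(g, r)` ([SemiAnbd] Ex. 2.10). [cite: MochizukiAbsTopI2012, Prop 2.2 p.18]
[cite: MochizukiSemiAnbd2006, Ex. 2.10 p.31] -/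
theorem isTopologicallyFinitelyGenerated_of_puncturedSurfaceGroup {g r : ℕ}
    (e : Γ ≃* PuncturedSurfaceGroup g r) (hι : IsProSigmaCompletion Sigma ι) :
    IsTopologicallyFinitelyGenerated P := by
  haveI : Group.FG (PuncturedSurfaceGroup g r) := fg_presentedGroup _
  haveI : Group.FG Γ := Group.fg_of_surjective (f := e.symm.toMonoidHom) e.symm.surjective
  exact isTopologicallyFinitelyGenerated_of_fg hι

end Literature.AnabelianGeometry.SemiGraphs.SemiGraphOfAnabelioids.IsProSigmaCompletion

namespace Literature.AnabelianGeometry.AbsoluteAnabelian.FundamentalExtension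

open Literature.AnabelianGeometry.SemiGraphs.SemiGraphOfAnabelioids
open Literature.GroupTheory.CombinatorialGroupTheory

/-- **F-0240 `GeomTFG` ([AbsTopI] Prop 2.2) for every extension whose `Δ` is a pro-`Σ` completion of
a finitely generated group**: if `1 → Δ → Π → G → 1` is an extension of profinite groups and `Δ` is
presented as a pro-`Σ` completion `ι : Γ → Δ` of a finitely generated `Γ` (e.g. `Γ = Γ_{g,r}`, the datum
carried by a hyperbolic curve of type `(g, r)`), then `Δ` is topologically finitely generated, i.e. the
typed predicate `E.GeomTFG` HOLDS.  (MODEL-level discharge; for an abstract `E` the predicate stays a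
hypothesis.) [cite: MochizukiAbsTopI2012, Prop 2.2 p.18] -/
theorem geomTFG_of_isProSigmaCompletion (E : FundamentalExtension.{u}) {Sigma : Set ℕ}
    {Γ : Type*} [Group Γ] [Group.FG Γ] (ι : Γ →* E.geom) (hι : IsProSigmaCompletion Sigma ι) :
    E.GeomTFG :=
  IsProSigmaCompletion.isTopologicallyFinitelyGenerated_of_fg hι

/-- **F-0240 `GeomTFG` at the surface-group model**: `Δ` presented as a pro-`Σ` completion of
`Γ_{g,r}`. [cite: MochizukiAbsTopI2012, Prop 2.2 p.18] [cite: MochizukiSemiAnbd2006, Ex. 2.10 p.31] -/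
theorem geomTFG_of_isProSigmaCompletion_puncturedSurfaceGroup (E : FundamentalExtension.{u})
    {Sigma : Set ℕ} {g r : ℕ} (ι : PuncturedSurfaceGroup g r →* E.geom)
    (hι : IsProSigmaCompletion Sigma ι) : E.GeomTFG :=
  IsProSigmaCompletion.isTopologicallyFinitelyGenerated_of_puncturedSurfaceGroup (MulEquiv.refl _) hι

end Literature.AnabelianGeometry.AbsoluteAnabelian.FundamentalExtension

end
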